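import Summits.CriticalPhenomena.SAWScalingLimit.Theorems.SAWRenewalTightnessConfinementPositivityUnpinnedSlabTubeCore
import Summits.CriticalPhenomena.SAWScalingLimit.Theorems.SAWRenewalTightnessConfinementPositivityChainTuples
import Summits.CriticalPhenomena.SAWScalingLimit.Theorems.SAWRenewalTightnessKestenIdentity
import Summits.CriticalPhenomena.SAWScalingLimit.Theorems.SAWRenewalTightnessStripMassConservation
import Literature.Probability.RandomPlanarGeometry.SAWRenewalBound
import Literature.Probability.RandomPlanarGeometry.SelfAvoidingWalkProofs
import Summits.CriticalPhenomena.SAWScalingLimit.Theorems.SAWRenewalTightnessShellCrossingBoundTiltedKraft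
import HarnessLib

/-!
# Crux `ConfinementPositivity` (stmt-CriticalPhenomena-17587), line `Sketch` (sign-universality):
# stub B′u `stub_unpinnedSlabTube` — the UNPINNED SLAB TUBE from U2 (extent second moment) and S (small pieces)

Registered stub B′u of the lead skeleton `Cruxes/ConfinementPositivity/Lines/Sketch.lean` (v2):
`ExtentSecondMoment → SmallPiecesFloor → UnpinnedSlabTube`, all three written out over Kesten CHAINS (lists of
irreducible bridge words, weighted `x_c^{Σ|w|}`): among the chains of total span `L ≤ aW`, those whose
concatenation stays in the tube `|y| ≤ W` carry a fraction `≥ c(a) > 0` of the critical mass.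

Proof.  `c(a) = min (x_c^{ab}/(ab+1)) (q·e⁻¹/2)` with `b = 128·⌈C⌉·a` (`C` the U2 constant, `q = q(a,b)` the
S constant).  Chains are re-indexed as tuples `Fin k → {w // IsIrrBridge w}`
(`Theorems.chainSpanMass_eq_tsum_tuples`, `…ChainTuples.lean`).
* Main regime `W ≥ b`: S gives `q·(all chains) ≤ (chains with all pieces small)`, and for each `k` the core
  comparison `Theorems.unpinnedSlabTube_main_k` (`…UnpinnedSlabTubeCore.lean`) gives
  `e⁻¹·(small)_k ≤ 2·(tube)_k`; its numeric hypothesis `2C(W/b)L ≤ (W/2/2)² + 1` is `numeric_main`.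
* Small regime `W < b`: then `L < ab`; the tube mass is at least the weight `x_c^L` of the straight chain of
  `L` one-step east pieces (`straightChain_le_tube`), and the total mass is `≤ L + 1` (the `k`-th term is `≤ 1`
  by Kesten's identity and vanishes for `k > L`, `tsum_tsum_span_le`).
No definitions; `ℝ≥0∞` throughout.
-/

noncomputable section

open scoped BigOperators ENNReal
open Classical
open Literature.Probability.LatticeModels
open Literature.Probability.RandomPlanarGeometry Literature.Probability.RandomPlanarGeometry.SAW

namespace Summit.CriticalPhenomena.SAWScalingLimit.Theorems

namespace UnpinnedSlabTube

/-! ### Small-regime inputs: the straight chain, and a crude upper bound on the total mass -/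

/-- A word all of whose letters are east steps has all heights `0`. -/
theorem traj_snd_eq_zero_of_forall_east (w : List Step) (hw : ∀ d ∈ w, d = 0) (t : ℕ) : traj w t 1 = 0 := by
  have key : ∀ u : List Step, (∀ d ∈ u, d = 0) → wEnd u 1 = 0 := by
    intro u
    induction u with
    | nil => intro _; rfl
    | cons d u ih =>
      intro h
      rw [wEnd_cons, Pi.add_apply, ih (fun d' hd' => h d' (List.mem_cons_of_mem _ hd')),
        h d List.mem_cons_self]
      decide
  exact key (w.take t) fun d hd => hw d (List.mem_of_mem_take hd)

/-- `Σ'_k Σ'_f [Σ span = L ∧ True] ∏ x_c^{|f i|} ≤ L + 1`: the `k`-th term vanishes for `k > L` (every piece has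
span `≥ 1`) and is `≤ 1` otherwise (Kesten). -/
theorem tsum_tsum_span_le (L : ℕ) :
    (∑' k : ℕ, ∑' f : Fin k → {w : List Step // IsIrrBridge w},
        if (∑ i, xEnd (f i).1) = (L : ℤ) then
          ∏ i, ENNReal.ofReal (criticalFugacity ^ (f i).1.length) else 0) ≤ (L : ℝ≥0∞) + 1 := by
  have hzero : ∀ k : ℕ, k ∉ Finset.range (L + 1) →
      (∑' f : Fin k → {w : List Step // IsIrrBridge w},
        if (∑ i, xEnd (f i).1) = (L : ℤ) then
          ∏ i, ENNReal.ofReal (criticalFugacity ^ (f i).1.length) else 0) = 0 := by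
    intro k hk
    rw [Finset.mem_range, not_lt] at hk
    refine ENNReal.tsum_eq_zero.2 fun f => if_neg ?_
    intro hsum
    have h1 : (k : ℤ) ≤ ∑ i, xEnd (f i).1 :=
      calc (k : ℤ) = ∑ _i : Fin k, (1 : ℤ) := by simp
        _ ≤ ∑ i, xEnd (f i).1 := Finset.sum_le_sum fun i _ => UnpinnedSlabTube.one_le_xEnd (f i)
    rw [hsum] at h1
    omega
  rw [tsum_eq_sum (s := Finset.range (L + 1)) hzero]
  calc (∑ k ∈ Finset.range (L + 1), ∑' f : Fin k → {w : List Step // IsIrrBridge w},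
        if (∑ i, xEnd (f i).1) = (L : ℤ) then
          ∏ i, ENNReal.ofReal (criticalFugacity ^ (f i).1.length) else 0)
      ≤ ∑ _k ∈ Finset.range (L + 1), (1 : ℝ≥0∞) :=
        Finset.sum_le_sum fun k _ => UnpinnedSlabTube.tsum_ite_prod_weight_le_one k _
    _ = (L : ℝ≥0∞) + 1 := by simp

/-- The straight chain of `L` one-step east pieces is a tube chain of span `L` and weight `x_c^L`. -/
theorem straightChain_le_tube (W L : ℕ) :
    ENNReal.ofReal (criticalFugacity ^ L) ≤
      ∑' k : ℕ, ∑' f : Fin k → {w : List Step // IsIrrBridge w},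
        if ((∑ i, xEnd (f i).1) = (L : ℤ) ∧
            ∀ t, |traj (List.ofFn fun i => (f i).1).flatten t 1| ≤ (W : ℤ)) then
          ∏ i, ENNReal.ofReal (criticalFugacity ^ (f i).1.length) else 0 := by
  refine le_trans ?_ (ENNReal.le_tsum L)
  let f₀ : Fin L → {w : List Step // IsIrrBridge w} := fun _ => ⟨[(0 : Step)], Renewal.isIrrBridge_single⟩
  refine le_trans (le_of_eq ?_) (ENNReal.le_tsum f₀)
  have hcond : ((∑ i, xEnd (f₀ i).1) = (L : ℤ) ∧
      ∀ t, |traj (List.ofFn fun i => (f₀ i).1).flatten t 1| ≤ (W : ℤ)) := by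
    constructor
    · simp [f₀, TiltedKraft.xEnd_single]
    · intro t
      rw [traj_snd_eq_zero_of_forall_east _ (fun d hd => ?_) t, abs_zero]
      · positivity
      simp only [f₀, List.mem_flatten, List.mem_ofFn', Set.mem_range] at hd
      obtain ⟨l, ⟨_, rfl⟩, hdl⟩ := hd
      simpa using hdl
  rw [if_pos hcond]
  simp only [f₀, List.length_singleton, pow_one, Finset.prod_const, Finset.card_univ, Fintype.card_fin]
  rw [ENNReal.ofReal_pow KestenIdentity.criticalFugacity_nonneg]

/-! ### The numeric condition of the main regime -/

/-- With `b = 128·Cn·a`, `L ≤ aW`: `2·Cn·(W/b)·L ≤ (W/2/2)² + 1`. -/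
theorem numeric_main (Cn a W L : ℕ) (hL : L ≤ a * W) :
    2 * Cn * (W / (128 * Cn * a)) * L ≤ (W / 2 / 2) ^ 2 + 1 := by
  set d := W / (128 * Cn * a) with hd
  set E := W / 2 / 2 with hE
  have h1 : d * (128 * Cn * a) ≤ W := Nat.div_mul_le_self W _
  have h2 : W ≤ 4 * E + 3 := by omega
  -- `64 · (2 Cn d L) ≤ (128 Cn a d) · W ≤ W²`
  have h3 : 64 * (2 * Cn * d * L) ≤ W * W := by
    calc 64 * (2 * Cn * d * L) ≤ 64 * (2 * Cn * d * (a * W)) := by gcongr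
      _ = (d * (128 * Cn * a)) * W := by ring
      _ ≤ W * W := Nat.mul_le_mul_right W h1
  -- `W² ≤ (4E+3)² ≤ 64 (E² + 1)`
  have h4a : W * W ≤ (4 * E + 3) * (4 * E + 3) := Nat.mul_le_mul h2 h2
  have h4b : 24 * E ≤ 48 * E ^ 2 + 55 := by
    rcases Nat.eq_zero_or_pos E with hE0 | hE0
    · simp [hE0]
    · nlinarith
  have h4 : W * W ≤ 64 * (E ^ 2 + 1) := by nlinarith [h4a, h4b]
  nlinarith [h3, h4]

/-! ### Assembly -/

end UnpinnedSlabTube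

open UnpinnedSlabTube in
/-- **Stub B′u `stub_unpinnedSlabTube`** (registered): the unpinned slab tube from the one-piece second-moment
ceiling U2 and the small-pieces floor S. -/
theorem stub_unpinnedSlabTube :
    (∃ C : ℝ, 0 < C ∧ ∀ s : ℕ, 1 ≤ s →
      (∑' w : {w : List Step // IsIrrBridge w},
          if xEnd w.1 = (s : ℤ) then
            (((Finset.range (w.1.length + 1)).sup fun i => (traj w.1 i 1).natAbs : ℕ) : ℝ≥0∞) ^ 2 *
              ENNReal.ofReal (criticalFugacity ^ w.1.length) else 0) ≤
        ENNReal.ofReal (C * (s : ℝ) ^ 2) *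
          ∑' w : {w : List Step // IsIrrBridge w},
            if xEnd w.1 = (s : ℤ) then 1 * ENNReal.ofReal (criticalFugacity ^ w.1.length) else 0) →
    (∀ a b : ℕ, 1 ≤ a → 1 ≤ b → ∃ q : ℝ, 0 < q ∧ ∀ W L : ℕ, b ≤ W → L ≤ a * W →
      ENNReal.ofReal q *
          (∑' l : {l : List (List Step) // (∀ w ∈ l, IsIrrBridge w) ∧ (l.map xEnd).sum = (L : ℤ) ∧ True},
            ENNReal.ofReal (criticalFugacity ^ (l.1.map List.length).sum)) ≤
        ∑' l : {l : List (List Step) // (∀ w ∈ l, IsIrrBridge w) ∧ (l.map xEnd).sum = (L : ℤ) ∧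
            ∀ w ∈ l, (b : ℤ) * xEnd w ≤ (W : ℤ)},
          ENNReal.ofReal (criticalFugacity ^ (l.1.map List.length).sum)) →
    (∀ a : ℕ, 1 ≤ a → ∃ c : ℝ, 0 < c ∧ ∀ W L : ℕ, 1 ≤ W → L ≤ a * W →
      ENNReal.ofReal c *
          (∑' l : {l : List (List Step) // (∀ w ∈ l, IsIrrBridge w) ∧ (l.map xEnd).sum = (L : ℤ) ∧ True},
            ENNReal.ofReal (criticalFugacity ^ (l.1.map List.length).sum)) ≤
        ∑' l : {l : List (List Step) // (∀ w ∈ l, IsIrrBridge w) ∧ (l.map xEnd).sum = (L : ℤ) ∧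
            ∀ i, |traj l.flatten i 1| ≤ (W : ℤ)},
          ENNReal.ofReal (criticalFugacity ^ (l.1.map List.length).sum)) := by
  intro hU2 hS a ha
  obtain ⟨C, hC, hU⟩ := hU2
  set Cn : ℕ := ⌈C⌉₊ with hCn_def
  have hCn1 : 1 ≤ Cn := Nat.ceil_pos.2 hC
  have hCle : ENNReal.ofReal C ≤ (Cn : ℝ≥0∞) := ENNReal.ofReal_le_natCast.2 (Nat.le_ceil C)
  set b : ℕ := 128 * Cn * a with hb_def
  have hb1 : 1 ≤ b := by
    have : 1 ≤ 128 * Cn * a := le_trans (Nat.mul_le_mul hCn1 ha) (by nlinarith)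
    simpa [hb_def] using this
  obtain ⟨q, hq, hSq⟩ := hS a b ha hb1
  set Lmax : ℕ := a * b with hLmax_def
  have hx0 : 0 < criticalFugacity := StripMass.criticalFugacity_pos
  have hx1 : criticalFugacity ≤ 1 := by linarith [SAW.criticalFugacity_le_half]
  refine ⟨min (criticalFugacity ^ Lmax / (Lmax + 1)) (q * Real.exp (-1) / 2),
    lt_min (by positivity) (by positivity), ?_⟩
  intro W L hW hL
  rw [chainSpanMass_eq_tsum_tuples (fun _ => True) (L : ℤ), chainSpanMass_eq_tsum_tuples (fun l => ∀ i, |traj l.flatten i 1| ≤ (W : ℤ)) (L : ℤ)]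
  simp only [and_true]
  by_cases hWb : b ≤ W
  · -- MAIN REGIME
    have hr : 1 ≤ W / 2 := by
      have : 128 ≤ b := by
        have h1 : 1 * 1 ≤ Cn * a := Nat.mul_le_mul hCn1 ha
        simp only [hb_def]; nlinarith
      omega
    have hnumN := numeric_main Cn a W L hL
    have hnum : 2 * ENNReal.ofReal C * ((W / b : ℕ) : ℝ≥0∞) * (L : ℝ≥0∞) ≤
        (((W / 2 / 2) ^ 2 + 1 : ℕ) : ℝ≥0∞) := by
      calc 2 * ENNReal.ofReal C * ((W / b : ℕ) : ℝ≥0∞) * (L : ℝ≥0∞)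
          ≤ 2 * (Cn : ℝ≥0∞) * ((W / b : ℕ) : ℝ≥0∞) * (L : ℝ≥0∞) := by gcongr
        _ = ((2 * Cn * (W / (128 * Cn * a)) * L : ℕ) : ℝ≥0∞) := by rw [hb_def]; push_cast; ring
        _ ≤ (((W / 2 / 2) ^ 2 + 1 : ℕ) : ℝ≥0∞) := by exact_mod_cast hnumN
    have hk : ∀ k : ℕ, ENNReal.ofReal (Real.exp (-1)) *
        (∑' f : Fin k → {w : List Step // IsIrrBridge w},
          if ((∑ i, xEnd (f i).1) = (L : ℤ) ∧ ∀ i, (b : ℤ) * xEnd (f i).1 ≤ (W : ℤ)) then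
            ∏ i, ENNReal.ofReal (criticalFugacity ^ (f i).1.length) else 0) ≤
        2 * ∑' f : Fin k → {w : List Step // IsIrrBridge w},
          if ((∑ i, xEnd (f i).1) = (L : ℤ) ∧
              ∀ t, |traj (List.ofFn fun i => (f i).1).flatten t 1| ≤ (W : ℤ)) then
            ∏ i, ENNReal.ofReal (criticalFugacity ^ (f i).1.length) else 0 :=
      fun k => unpinnedSlabTube_main_k hC hU W b L k hb1 hr hnum
    -- S, with the membership form converted to the tuple form
    have hSq' := hSq W L hWb hL
    rw [chainSpanMass_eq_tsum_tuples (fun _ => True) (L : ℤ), chainSpanMass_eq_tsum_tuples (fun l => ∀ w ∈ l, (b : ℤ) * xEnd w ≤ (W : ℤ)) (L : ℤ)] at hSq'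
    simp only [and_true, List.forall_mem_ofFn_iff] at hSq'
    -- the chain of inequalities
    have hc2 : ENNReal.ofReal (min (criticalFugacity ^ Lmax / (Lmax + 1)) (q * Real.exp (-1) / 2)) ≤
        ENNReal.ofReal q * ENNReal.ofReal (Real.exp (-1)) / 2 := by
      rw [← ENNReal.ofReal_mul hq.le, ← ENNReal.ofReal_ofNat 2,
        ← ENNReal.ofReal_div_of_pos (by norm_num : (0 : ℝ) < 2)]
      exact ENNReal.ofReal_le_ofReal (min_le_right _ _)
    calc ENNReal.ofReal (min (criticalFugacity ^ Lmax / (Lmax + 1)) (q * Real.exp (-1) / 2)) *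
          (∑' k : ℕ, ∑' f : Fin k → {w : List Step // IsIrrBridge w},
            if (∑ i, xEnd (f i).1) = (L : ℤ) then
              ∏ i, ENNReal.ofReal (criticalFugacity ^ (f i).1.length) else 0)
        ≤ (ENNReal.ofReal q * ENNReal.ofReal (Real.exp (-1)) / 2) *
          (∑' k : ℕ, ∑' f : Fin k → {w : List Step // IsIrrBridge w},
            if (∑ i, xEnd (f i).1) = (L : ℤ) then
              ∏ i, ENNReal.ofReal (criticalFugacity ^ (f i).1.length) else 0) := mul_le_mul_left hc2 _
      _ = (ENNReal.ofReal (Real.exp (-1)) / 2) * (ENNReal.ofReal q *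
          (∑' k : ℕ, ∑' f : Fin k → {w : List Step // IsIrrBridge w},
            if (∑ i, xEnd (f i).1) = (L : ℤ) then
              ∏ i, ENNReal.ofReal (criticalFugacity ^ (f i).1.length) else 0)) := by
          rw [div_eq_mul_inv, div_eq_mul_inv]; ring
      _ ≤ (ENNReal.ofReal (Real.exp (-1)) / 2) *
          (∑' k : ℕ, ∑' f : Fin k → {w : List Step // IsIrrBridge w},
            if ((∑ i, xEnd (f i).1) = (L : ℤ) ∧ ∀ i, (b : ℤ) * xEnd (f i).1 ≤ (W : ℤ)) then
              ∏ i, ENNReal.ofReal (criticalFugacity ^ (f i).1.length) else 0) := mul_le_mul_right hSq' _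
      _ = ∑' k : ℕ, (ENNReal.ofReal (Real.exp (-1)) / 2) *
          ∑' f : Fin k → {w : List Step // IsIrrBridge w},
            if ((∑ i, xEnd (f i).1) = (L : ℤ) ∧ ∀ i, (b : ℤ) * xEnd (f i).1 ≤ (W : ℤ)) then
              ∏ i, ENNReal.ofReal (criticalFugacity ^ (f i).1.length) else 0 := by rw [ENNReal.tsum_mul_left]
      _ ≤ ∑' k : ℕ, ∑' f : Fin k → {w : List Step // IsIrrBridge w},
          if ((∑ i, xEnd (f i).1) = (L : ℤ) ∧
              ∀ t, |traj (List.ofFn fun i => (f i).1).flatten t 1| ≤ (W : ℤ)) then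
            ∏ i, ENNReal.ofReal (criticalFugacity ^ (f i).1.length) else 0 := by
          refine ENNReal.tsum_le_tsum fun k => ?_
          have hre : ∀ a m : ℝ≥0∞, a / 2 * m = a * m / 2 := fun a m => by
            rw [div_eq_mul_inv, div_eq_mul_inv]; ring
          rw [hre, ENNReal.div_le_iff two_ne_zero ENNReal.ofNat_ne_top, mul_comm _ (2 : ℝ≥0∞)]
          exact hk k
  · -- SMALL REGIME: `W < b`, so `L ≤ aW < ab = Lmax`
    have hWb' : W < b := not_le.1 hWb
    have hLlt : L < Lmax := by
      calc L ≤ a * W := hL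
        _ < a * b := (Nat.mul_lt_mul_left (by omega)).2 hWb'
    have hLle : L ≤ Lmax := hLlt.le
    calc ENNReal.ofReal (min (criticalFugacity ^ Lmax / (Lmax + 1)) (q * Real.exp (-1) / 2)) *
          (∑' k : ℕ, ∑' f : Fin k → {w : List Step // IsIrrBridge w},
            if (∑ i, xEnd (f i).1) = (L : ℤ) then
              ∏ i, ENNReal.ofReal (criticalFugacity ^ (f i).1.length) else 0)
        ≤ ENNReal.ofReal (criticalFugacity ^ Lmax / (Lmax + 1)) * ((L : ℝ≥0∞) + 1) :=
          mul_le_mul (ENNReal.ofReal_le_ofReal (min_le_left _ _)) (tsum_tsum_span_le L) zero_le zero_le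
      _ = ENNReal.ofReal (criticalFugacity ^ Lmax / (Lmax + 1) * ((L : ℝ) + 1)) := by
          rw [ENNReal.ofReal_mul (by positivity)]
          congr 1
          rw [← ENNReal.ofReal_natCast, ← ENNReal.ofReal_one, ← ENNReal.ofReal_add (by positivity) zero_le_one]
      _ ≤ ENNReal.ofReal (criticalFugacity ^ L) := by
          refine ENNReal.ofReal_le_ofReal ?_
          have hL1 : (L : ℝ) + 1 ≤ (Lmax : ℝ) + 1 := by exact_mod_cast Nat.succ_le_succ hLle
          have hpow : criticalFugacity ^ Lmax ≤ criticalFugacity ^ L :=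
            pow_le_pow_of_le_one hx0.le hx1 hLle
          have hLmax : (0 : ℝ) < (Lmax : ℝ) + 1 := by positivity
          calc criticalFugacity ^ Lmax / (Lmax + 1) * ((L : ℝ) + 1)
              ≤ criticalFugacity ^ Lmax / (Lmax + 1) * ((Lmax : ℝ) + 1) := by gcongr
            _ = criticalFugacity ^ Lmax := by field_simp
            _ ≤ criticalFugacity ^ L := hpow
      _ ≤ _ := straightChain_le_tube W L

end Summit.CriticalPhenomena.SAWScalingLimit.Theorems
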